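import Mathlib
import HarnessLib
import Summits.Ventures.LatticeQCDFlow.Exactness.FlowPushforward
import Summits.Ventures.LatticeQCDFlow.Exactness.SU2TorusAlcoveJacobian
import Summits.Ventures.LatticeQCDFlow.Exactness.JacobianRestrictDensity
import Summits.Ventures.LatticeQCDFlow.Exactness.StickBreakingFinTwo
import Summits.Ventures.LatticeQCDFlow.Exactness.PolarChartSU3

/-!
# The POLAR cell of the `SU(3)` spectral flow is exact: the chart presents Lebesgue measure on the alcove, and box flows become alcove flows with the booked correction

HONEST FRAMING: exact (Metropolis-corrected) sampling algorithms for lattice gauge theory;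
figures of merit are autocorrelation/cost numbers at stated couplings and volumes; no
continuum-physics claim.

Venture `LatticeQCDFlow` (cell pub-lqcd), topic `Exactness`; FANOUT row 10 (`eng-equiv`, engine
`latflow.equiv` v0.3 `spectral_kernel(3, cell='polar')`: `ldj = ld_chi + ld_polar_out − ld_polar_in + …`
with `ld_polar = log r + log R(φ) + log(π/3)`; Abbott et al. arXiv:2305.02402 §4.1.1, named only).
NEW WORK of the cell over `PolarChartSU3` (the two factors `T` box → wedge, `Q` wedge → alcove: derivatives,
determinants, injectivity, images), Mathlib's change of variables
`map_withDensity_abs_det_fderiv_eq_addHaar`, and the tree's `hasJacobian_of_presentation_ae`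
(`SU2TorusAlcoveJacobian`), `HasJacobian.withDensity_of_pos_ae` (`JacobianRestrictDensity`),
`measurableSet_openBox_two` (`StickBreakingFinTwo`).  The twin, for the polar cell, of
`StickBreakingFinTwo` + `AlcoveAffineChartSU3` (the simplex cell); its output feeds
`SU3TorusAlcoveJacobian.hasJacobian_su3Torus_of_alcoveMap` exactly like theirs.  Nothing is cited as a
fact; no number; no definition.

* `hasFDerivWithinAt_polarChart_su3`, `det_polarChartDeriv_su3`
  (`det d(Q∘T)(a) = (−2√3·ρ(a))·((π/3)·π/(√3 cos ψ(a)))`, `ρ(a) = (T a)₁`, `ψ(a) = π/3·a₀ − π/6`; its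
  absolute value is `(2π²/3)·ρ/cos ψ` — the engine's `exp(ld_polar) = r·R(φ)·π/3` up to the constant
  `π/3·… ` bookkeeping of the orthonormal plane basis, which cancels in `ld_polar_out − ld_polar_in`),
  `injOn_polarChart_su3`, `image_polarChart_su3` (`(Q∘T)(B) = ` the alcove);
* **`map_polarChart_su3`** — `(Q∘T)_* (|det| · Leb|_B) = Leb|_{alcove}`;
* **`hasJacobian_alcove_of_polarBoxFlow_su3`** — a box flow `χ` with `HasJacobian (Leb|_B) χ Jχ`
  induces through the polar chart an alcove flow `G` (`G ∘ (Q∘T) = (Q∘T) ∘ χ` a.e. on `B`) with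
  `HasJacobian (Leb|_{alcove}) G J_G` for any measurable `G`, `J_G` with
  `J_G((Q∘T) a) = |det|(χ a)·Jχ(a)/|det|(a)` a.e.: on the polar cell the engine's
  `ld_chi + ld_polar_out − ld_polar_in` is an exact log-Jacobian.
-/

noncomputable section

namespace Summit.Ventures.LatticeQCDFlow.Exactness

open MeasureTheory Set Real
open scoped ENNReal

section PolarCell

variable {T Q : (Fin 2 → ℝ) → (Fin 2 → ℝ)}
  (hT : ∀ a, T a = ![π / 3 * a 0, a 1 * (π / (Real.sqrt 3 * Real.cos (π / 3 * a 0 - π / 6)))])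
  (hQ : ∀ z, Q z = ![-2 * z 1 * Real.cos (z 0), z 1 * Real.cos (z 0) - Real.sqrt 3 * z 1 * Real.sin (z 0)])

/-- On the box the wedge angle has positive cosines. -/
theorem cos_boxAngle_pos {a : Fin 2 → ℝ} (ha : a ∈ Set.pi univ fun _ : Fin 2 => Ioo (0 : ℝ) 1) :
    0 < Real.cos (π / 3 * a 0 - π / 6) := by
  have ha0 := ha 0 (mem_univ _)
  have hπ := Real.pi_pos
  exact (wedgeAngle_pos (φ := π / 3 * a 0) (by nlinarith [ha0.1]) (by nlinarith [ha0.2])).2.2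

/-- Determinant of a composition of continuous linear endomorphisms (the `LinearMap.det_comp` of the
underlying linear maps). -/
theorem clm_det_comp (A B : (Fin 2 → ℝ) →L[ℝ] (Fin 2 → ℝ)) : (A.comp B).det = A.det * B.det := by
  unfold ContinuousLinearMap.det
  rw [show ((A.comp B : (Fin 2 → ℝ) →L[ℝ] (Fin 2 → ℝ)) : (Fin 2 → ℝ) →ₗ[ℝ] (Fin 2 → ℝ)) =
    (A : (Fin 2 → ℝ) →ₗ[ℝ] (Fin 2 → ℝ)).comp (B : (Fin 2 → ℝ) →ₗ[ℝ] (Fin 2 → ℝ)) from rfl, LinearMap.det_comp]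

include hT hQ

/-- **Derivative of the polar chart `Q ∘ T` on the box** (chain rule over `PolarChartSU3`). -/
theorem hasFDerivWithinAt_polarChart_su3 {a : Fin 2 → ℝ} (ha : a ∈ Set.pi univ fun _ : Fin 2 => Ioo (0 : ℝ) 1) :
    HasFDerivWithinAt (Q ∘ T)
      ((ContinuousLinearMap.pi ![
        (-2 * (T a) 1) • ((-Real.sin ((T a) 0)) • ContinuousLinearMap.proj (R := ℝ) (φ := fun _ : Fin 2 => ℝ) 0) +
          Real.cos ((T a) 0) • ((-2 : ℝ) • ContinuousLinearMap.proj (R := ℝ) (φ := fun _ : Fin 2 => ℝ) 1),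
        ((T a) 1 • ((-Real.sin ((T a) 0)) • ContinuousLinearMap.proj (R := ℝ) (φ := fun _ : Fin 2 => ℝ) 0) +
            Real.cos ((T a) 0) • ContinuousLinearMap.proj (R := ℝ) (φ := fun _ : Fin 2 => ℝ) 1) -
          ((Real.sqrt 3 * (T a) 1) • (Real.cos ((T a) 0) • ContinuousLinearMap.proj (R := ℝ) (φ := fun _ : Fin 2 => ℝ) 0) +
            Real.sin ((T a) 0) • (Real.sqrt 3 • ContinuousLinearMap.proj (R := ℝ) (φ := fun _ : Fin 2 => ℝ) 1))]).comp
        (ContinuousLinearMap.pi ![(π / 3) • ContinuousLinearMap.proj (R := ℝ) (φ := fun _ : Fin 2 => ℝ) 0,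
          a 1 • ((π * (Real.sqrt 3 * (Real.sin (π / 3 * a 0 - π / 6) * (π / 3))) /
              (Real.sqrt 3 * Real.cos (π / 3 * a 0 - π / 6)) ^ 2) •
              ContinuousLinearMap.proj (R := ℝ) (φ := fun _ : Fin 2 => ℝ) 0) +
            (π / (Real.sqrt 3 * Real.cos (π / 3 * a 0 - π / 6))) •
              ContinuousLinearMap.proj (R := ℝ) (φ := fun _ : Fin 2 => ℝ) 1]))
      (Set.pi univ fun _ : Fin 2 => Ioo (0 : ℝ) 1) a := by
  obtain rfl : T = _ := funext hT
  obtain rfl : Q = _ := funext hQ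
  exact ((hasFDerivAt_wedgeToAlcove_su3 _).comp a
    (hasFDerivAt_boxToWedge_su3 a (cos_boxAngle_pos ha).ne')).hasFDerivWithinAt

omit hT hQ in
/-- **Its determinant**: `det dQ(T a) · det dT(a) = (−2√3 ρ)·((π/3)·π/(√3 cos ψ))`. -/
theorem det_polarChartDeriv_su3 (a : Fin 2 → ℝ) :
    ((ContinuousLinearMap.pi ![
        (-2 * (T a) 1) • ((-Real.sin ((T a) 0)) • ContinuousLinearMap.proj (R := ℝ) (φ := fun _ : Fin 2 => ℝ) 0) +
          Real.cos ((T a) 0) • ((-2 : ℝ) • ContinuousLinearMap.proj (R := ℝ) (φ := fun _ : Fin 2 => ℝ) 1),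
        ((T a) 1 • ((-Real.sin ((T a) 0)) • ContinuousLinearMap.proj (R := ℝ) (φ := fun _ : Fin 2 => ℝ) 0) +
            Real.cos ((T a) 0) • ContinuousLinearMap.proj (R := ℝ) (φ := fun _ : Fin 2 => ℝ) 1) -
          ((Real.sqrt 3 * (T a) 1) • (Real.cos ((T a) 0) • ContinuousLinearMap.proj (R := ℝ) (φ := fun _ : Fin 2 => ℝ) 0) +
            Real.sin ((T a) 0) • (Real.sqrt 3 • ContinuousLinearMap.proj (R := ℝ) (φ := fun _ : Fin 2 => ℝ) 1))]).comp
        (ContinuousLinearMap.pi ![(π / 3) • ContinuousLinearMap.proj (R := ℝ) (φ := fun _ : Fin 2 => ℝ) 0,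
          a 1 • ((π * (Real.sqrt 3 * (Real.sin (π / 3 * a 0 - π / 6) * (π / 3))) /
              (Real.sqrt 3 * Real.cos (π / 3 * a 0 - π / 6)) ^ 2) •
              ContinuousLinearMap.proj (R := ℝ) (φ := fun _ : Fin 2 => ℝ) 0) +
            (π / (Real.sqrt 3 * Real.cos (π / 3 * a 0 - π / 6))) •
              ContinuousLinearMap.proj (R := ℝ) (φ := fun _ : Fin 2 => ℝ) 1])).det =
      (-2 * Real.sqrt 3 * (T a) 1) * (π / 3 * (π / (Real.sqrt 3 * Real.cos (π / 3 * a 0 - π / 6)))) := by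
  rw [clm_det_comp, det_wedgeToAlcoveDeriv_su3 (T a), det_boxToWedgeDeriv_su3 a]

/-- **The polar chart is injective on the box.** -/
theorem injOn_polarChart_su3 : InjOn (Q ∘ T) (Set.pi univ fun _ : Fin 2 => Ioo (0 : ℝ) 1) := by
  obtain rfl : T = _ := funext hT
  obtain rfl : Q = _ := funext hQ
  refine injOn_wedgeToAlcove_su3.comp injOn_boxToWedge_su3 fun a ha => ?_
  have hmem : (fun a : Fin 2 → ℝ =>
      (![π / 3 * a 0, a 1 * (π / (Real.sqrt 3 * Real.cos (π / 3 * a 0 - π / 6)))] : Fin 2 → ℝ)) a ∈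
      (fun a : Fin 2 → ℝ =>
        (![π / 3 * a 0, a 1 * (π / (Real.sqrt 3 * Real.cos (π / 3 * a 0 - π / 6)))] : Fin 2 → ℝ)) ''
        (Set.pi univ fun _ : Fin 2 => Ioo (0 : ℝ) 1) := mem_image_of_mem _ ha
  rw [image_boxToWedge_su3] at hmem
  exact ⟨hmem.1, hmem.2.1, hmem.2.2.1⟩

/-- **The image of the box under the polar chart is the alcove.** -/
theorem image_polarChart_su3 :
    (Q ∘ T) '' (Set.pi univ fun _ : Fin 2 => Ioo (0 : ℝ) 1) =
      {θ : Fin 2 → ℝ | θ 0 < θ 1 ∧ θ 1 < -(θ 0 + θ 1) ∧ -(θ 0 + θ 1) < θ 0 + 2 * π} := by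
  obtain rfl : T = _ := funext hT
  obtain rfl : Q = _ := funext hQ
  rw [Set.image_comp, image_boxToWedge_su3, image_wedgeToAlcove_su3]

/-- **The polar chart presents Lebesgue measure on the alcove**:
`(Q∘T)_* (|det d(Q∘T)| · Leb|_B) = Leb|_{alcove}` (change of variables). -/
theorem map_polarChart_su3 :
    Measure.map (Q ∘ T)
      ((volume.restrict (Set.pi univ fun _ : Fin 2 => Ioo (0 : ℝ) 1)).withDensity fun a =>
        ENNReal.ofReal |(-2 * Real.sqrt 3 * (T a) 1) * (π / 3 * (π / (Real.sqrt 3 * Real.cos (π / 3 * a 0 - π / 6))))|) =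
      volume.restrict {θ : Fin 2 → ℝ | θ 0 < θ 1 ∧ θ 1 < -(θ 0 + θ 1) ∧ -(θ 0 + θ 1) < θ 0 + 2 * π} := by
  have h := map_withDensity_abs_det_fderiv_eq_addHaar (volume : Measure (Fin 2 → ℝ))
    measurableSet_openBox_two.nullMeasurableSet
    (fun a ha => hasFDerivWithinAt_polarChart_su3 hT hQ ha) (injOn_polarChart_su3 hT hQ)
  simp_rw [det_polarChartDeriv_su3] at h
  rw [image_polarChart_su3 hT hQ] at h
  exact h

/-- **Box flows in the polar cell become alcove flows with the booked correction.**  `χ` a box flow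
with `HasJacobian (Leb|_B) χ Jχ`; `G` measurable with `G((Q∘T) a) = (Q∘T)(χ a)` for a.e. `a ∈ B`;
`J_G` measurable with `J_G((Q∘T) a) = D(χ a)·Jχ(a)/D(a)` for a.e. `a ∈ B`, `D = |det d(Q∘T)|`.  Then
`HasJacobian (Leb|_{alcove}) G J_G` — the hypothesis of `SU3TorusAlcoveJacobian.hasJacobian_su3Torus_of_alcoveMap`
for the engine's `cell='polar'`. -/
theorem hasJacobian_alcove_of_polarBoxFlow_su3 {χ : (Fin 2 → ℝ) → (Fin 2 → ℝ)} {Jχ : (Fin 2 → ℝ) → ℝ≥0∞}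
    (hχ : HasJacobian (volume.restrict (Set.pi univ fun _ : Fin 2 => Ioo (0 : ℝ) 1)) χ Jχ)
    {G : (Fin 2 → ℝ) → (Fin 2 → ℝ)} (hG : Measurable G) {JG : (Fin 2 → ℝ) → ℝ≥0∞} (hJG : Measurable JG)
    (hcomm : ∀ᵐ a ∂(volume.restrict (Set.pi univ fun _ : Fin 2 => Ioo (0 : ℝ) 1)), G (Q (T a)) = Q (T (χ a)))
    (hJ : ∀ᵐ a ∂(volume.restrict (Set.pi univ fun _ : Fin 2 => Ioo (0 : ℝ) 1)),
      JG (Q (T a)) =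
        ENNReal.ofReal |(-2 * Real.sqrt 3 * (T (χ a)) 1) * (π / 3 * (π / (Real.sqrt 3 * Real.cos (π / 3 * (χ a) 0 - π / 6))))| *
          Jχ a /
        ENNReal.ofReal |(-2 * Real.sqrt 3 * (T a) 1) * (π / 3 * (π / (Real.sqrt 3 * Real.cos (π / 3 * a 0 - π / 6))))|) :
    HasJacobian (volume.restrict {θ : Fin 2 → ℝ | θ 0 < θ 1 ∧ θ 1 < -(θ 0 + θ 1) ∧ -(θ 0 + θ 1) < θ 0 + 2 * π}) G JG := by
  have hπ := Real.pi_pos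
  -- measurability of the charts and of the density
  have hm0 : Measurable fun a : Fin 2 → ℝ => a 0 := measurable_pi_apply 0
  have hm1 : Measurable fun a : Fin 2 → ℝ => a 1 := measurable_pi_apply 1
  have hginv : Measurable fun a : Fin 2 → ℝ => π / (Real.sqrt 3 * Real.cos (π / 3 * a 0 - π / 6)) :=
    measurable_const.div (measurable_const.mul (Real.measurable_cos.comp ((hm0.const_mul _).sub measurable_const)))
  have hT1 : Measurable fun a : Fin 2 → ℝ => a 1 * (π / (Real.sqrt 3 * Real.cos (π / 3 * a 0 - π / 6))) :=
    hm1.mul hginv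
  have hT0 : Measurable fun a : Fin 2 → ℝ => π / 3 * a 0 := hm0.const_mul _
  have hcos0 : Measurable fun a : Fin 2 → ℝ => Real.cos (a 0) := Real.measurable_cos.comp hm0
  have hsin0 : Measurable fun a : Fin 2 → ℝ => Real.sin (a 0) := Real.measurable_sin.comp hm0
  have hQ0 : Measurable fun z : Fin 2 → ℝ => -2 * z 1 * Real.cos (z 0) := (hm1.const_mul _).mul hcos0
  have hQ1 : Measurable fun z : Fin 2 → ℝ => z 1 * Real.cos (z 0) - Real.sqrt 3 * z 1 * Real.sin (z 0) :=
    (hm1.mul hcos0).sub ((hm1.const_mul _).mul hsin0)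
  have hTm : Measurable T := by
    rw [show T = _ from funext hT]
    exact measurable_pi_lambda _ fun i => by
      fin_cases i
      · simpa using hT0
      · simpa using hT1
  have hQm : Measurable Q := by
    rw [show Q = _ from funext hQ]
    exact measurable_pi_lambda _ fun i => by
      fin_cases i
      · simpa using hQ0
      · simpa using hQ1
  have hSm : Measurable (Q ∘ T) := hQm.comp hTm
  have hDm : Measurable fun a : Fin 2 → ℝ =>
      ENNReal.ofReal |(-2 * Real.sqrt 3 * (T a) 1) * (π / 3 * (π / (Real.sqrt 3 * Real.cos (π / 3 * a 0 - π / 6))))| :=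
    ENNReal.measurable_ofReal.comp
      (((measurable_const.mul ((measurable_pi_apply 1).comp hTm)).mul (measurable_const.mul hginv)).abs)
  -- on the box the density is positive and finite
  have hD0 : ∀ᵐ a ∂(volume.restrict (Set.pi univ fun _ : Fin 2 => Ioo (0 : ℝ) 1)),
      ENNReal.ofReal |(-2 * Real.sqrt 3 * (T a) 1) * (π / 3 * (π / (Real.sqrt 3 * Real.cos (π / 3 * a 0 - π / 6))))| ≠ 0 := by
    refine (ae_restrict_iff' measurableSet_openBox_two).mpr (Filter.Eventually.of_forall fun a ha => ?_)
    have ha1 := ha 1 (mem_univ _)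
    have hc := cos_boxAngle_pos ha
    have h3 : (0 : ℝ) < Real.sqrt 3 := Real.sqrt_pos.mpr (by norm_num)
    have hg : 0 < π / (Real.sqrt 3 * Real.cos (π / 3 * a 0 - π / 6)) := by positivity
    have hρ : 0 < (T a) 1 := by
      rw [hT]; simp only [Matrix.cons_val_one, Matrix.cons_val_zero]
      exact mul_pos ha1.1 hg
    rw [ne_eq, ENNReal.ofReal_eq_zero, not_le, abs_pos]
    have : 0 < 2 * Real.sqrt 3 * (T a) 1 * (π / 3 * (π / (Real.sqrt 3 * Real.cos (π / 3 * a 0 - π / 6)))) := by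
      positivity
    nlinarith [this]
  have hDtop : ∀ᵐ a ∂(volume.restrict (Set.pi univ fun _ : Fin 2 => Ioo (0 : ℝ) 1)),
      ENNReal.ofReal |(-2 * Real.sqrt 3 * (T a) 1) * (π / 3 * (π / (Real.sqrt 3 * Real.cos (π / 3 * a 0 - π / 6))))| ≠ ∞ :=
    Filter.Eventually.of_forall fun a => ENNReal.ofReal_ne_top
  -- the box flow against the chart density, transported along the chart
  have hχ' := hχ.withDensity_of_pos_ae hDm hD0 hDtop
  refine hasJacobian_of_presentation_ae hSm (map_polarChart_su3 hT hQ) hχ' hG hJG ?_ ?_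
  · exact (withDensity_absolutelyContinuous _ _) hcomm
  · exact (withDensity_absolutelyContinuous _ _) hJ

end PolarCell

section PolarCellBooked

/-! ### The booked form of the polar correction (appended 2026-08-24, GEN 14)

The engine books, per configuration of the polar cell, `ld_polar = log r + log R(φ) + log(π/3)` with
`φ = (T a)₀ = π/3·a₀` (the wedge angle), `r = (T a)₁` (the radius) and `R(φ) = π/(√3·cos(φ − π/6))`
(the distance from the apex to the far edge of the wedge at angle `φ`), and corrects a box flow `χ` by
`ld_chi + ld_polar(χ a) − ld_polar(a)`.  The theorems below identify the chart density of this file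
with that booked factor — `|det d(Q∘T)(a)| = 2√3 · r·R(φ)·π/3` on the box, the constant `2√3 = 6/√3`
combining the scale of the chart's radial coordinate (`‖(θ₀, θ₁, θ₂)‖ = √6·ρ` in `ℝ³`) with the Gram
factor `√3` of the angle coordinates `(θ₀, θ₁)` of the plane `θ₀ + θ₁ + θ₂ = 0` — and restate `hasJacobian_alcove_of_polarBoxFlow_su3` with EXACTLY the booked correction
`exp(ld_polar(χ a) − ld_polar(a)) · Jχ(a)` (the constant cancels). -/

variable {T Q : (Fin 2 → ℝ) → (Fin 2 → ℝ)}
  (hT : ∀ a, T a = ![π / 3 * a 0, a 1 * (π / (Real.sqrt 3 * Real.cos (π / 3 * a 0 - π / 6)))])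
  (hQ : ∀ z, Q z = ![-2 * z 1 * Real.cos (z 0), z 1 * Real.cos (z 0) - Real.sqrt 3 * z 1 * Real.sin (z 0)])

include hT

/-- **The booked polar factor is positive on the box**: `r·R(φ)·(π/3) > 0` for `a ∈ B = (0,1)²`, where
`φ = (T a)₀`, `r = (T a)₁`, `R(φ) = π/(√3·cos(φ − π/6))`. -/
theorem polarBookedFactor_pos {a : Fin 2 → ℝ} (ha : a ∈ Set.pi univ fun _ : Fin 2 => Ioo (0 : ℝ) 1) :
    0 < (T a) 1 * (π / (Real.sqrt 3 * Real.cos ((T a) 0 - π / 6))) * (π / 3) := by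
  have ha1 := ha 1 (mem_univ _)
  have hc := cos_boxAngle_pos ha
  have hπ := Real.pi_pos
  have h3 : (0 : ℝ) < Real.sqrt 3 := Real.sqrt_pos.mpr (by norm_num)
  have hT0 : (T a) 0 = π / 3 * a 0 := by
    rw [hT]; simp only [Matrix.cons_val_zero]
  have hT1 : (T a) 1 = a 1 * (π / (Real.sqrt 3 * Real.cos (π / 3 * a 0 - π / 6))) := by
    rw [hT]; simp only [Matrix.cons_val_one, Matrix.cons_val_zero]
  have hR : 0 < π / (Real.sqrt 3 * Real.cos (π / 3 * a 0 - π / 6)) := div_pos hπ (mul_pos h3 hc)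
  rw [hT0, hT1]
  exact mul_pos (mul_pos (mul_pos ha1.1 hR) hR) (div_pos hπ (by norm_num))

/-- **The polar chart's Jacobian determinant is `2√3` times the booked factor**: for `a ∈ B`,
`|det d(Q∘T)(a)| = |(−2√3·r)·((π/3)·R(φ))| = 2√3 · (r·R(φ)·π/3)` — i.e. `exp(ld_polar)` of the engine up to
the constant `2√3` (coordinate normalisations), which cancels in `ld_polar_out − ld_polar_in`. -/
theorem abs_det_polarChartDeriv_su3_eq_booked {a : Fin 2 → ℝ}
    (ha : a ∈ Set.pi univ fun _ : Fin 2 => Ioo (0 : ℝ) 1) :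
    |(-2 * Real.sqrt 3 * (T a) 1) * (π / 3 * (π / (Real.sqrt 3 * Real.cos (π / 3 * a 0 - π / 6))))| =
      2 * Real.sqrt 3 * ((T a) 1 * (π / (Real.sqrt 3 * Real.cos ((T a) 0 - π / 6))) * (π / 3)) := by
  have hpos := polarBookedFactor_pos hT ha
  have hT0 : (T a) 0 = π / 3 * a 0 := by
    rw [hT]; simp only [Matrix.cons_val_zero]
  rw [hT0] at hpos ⊢
  have h3 : (0 : ℝ) < 2 * Real.sqrt 3 := mul_pos two_pos (Real.sqrt_pos.mpr (by norm_num))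
  rw [show (-2 * Real.sqrt 3 * (T a) 1) * (π / 3 * (π / (Real.sqrt 3 * Real.cos (π / 3 * a 0 - π / 6)))) =
      -(2 * Real.sqrt 3 * ((T a) 1 * (π / (Real.sqrt 3 * Real.cos (π / 3 * a 0 - π / 6))) * (π / 3))) by ring,
    abs_neg, abs_of_pos (mul_pos h3 hpos)]

/-- **The booked ratio.**  For `a, b ∈ B` and any `J : ℝ≥0∞`,
`D(b)·J/D(a) = ofReal(exp(ld_polar(b))/exp(ld_polar(a)))·J` with `D = |det d(Q∘T)|`: the constant
`2√3` cancels, leaving exactly the engine's `exp(ld_polar_out − ld_polar_in)`. -/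
theorem polarDensity_ratio_eq_booked {a b : Fin 2 → ℝ}
    (ha : a ∈ Set.pi univ fun _ : Fin 2 => Ioo (0 : ℝ) 1) (hb : b ∈ Set.pi univ fun _ : Fin 2 => Ioo (0 : ℝ) 1)
    (J : ℝ≥0∞) :
    ENNReal.ofReal |(-2 * Real.sqrt 3 * (T b) 1) * (π / 3 * (π / (Real.sqrt 3 * Real.cos (π / 3 * b 0 - π / 6))))| *
          J /
        ENNReal.ofReal |(-2 * Real.sqrt 3 * (T a) 1) * (π / 3 * (π / (Real.sqrt 3 * Real.cos (π / 3 * a 0 - π / 6))))| =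
      ENNReal.ofReal (((T b) 1 * (π / (Real.sqrt 3 * Real.cos ((T b) 0 - π / 6))) * (π / 3)) /
          ((T a) 1 * (π / (Real.sqrt 3 * Real.cos ((T a) 0 - π / 6))) * (π / 3))) * J := by
  rw [abs_det_polarChartDeriv_su3_eq_booked hT ha, abs_det_polarChartDeriv_su3_eq_booked hT hb]
  have hpa := polarBookedFactor_pos hT ha
  have h3 : (0 : ℝ) < 2 * Real.sqrt 3 := mul_pos two_pos (Real.sqrt_pos.mpr (by norm_num))
  rw [ENNReal.mul_div_right_comm, ← ENNReal.ofReal_div_of_pos (mul_pos h3 hpa), mul_div_mul_left _ _ h3.ne']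

include hQ

/-- **Box flows in the polar cell become alcove flows with EXACTLY the booked correction
`ld_chi + ld_polar_out − ld_polar_in`.**  `χ` a box flow with `HasJacobian (Leb|_B) χ Jχ` mapping `B`
into `B` a.e.; `G` measurable with `G((Q∘T) a) = (Q∘T)(χ a)` a.e. on `B`; `J_G` measurable with, a.e. on `B`,
`J_G((Q∘T) a) = ofReal( (r'·R(φ')·π/3) / (r·R(φ)·π/3) ) · Jχ(a)` (primes at `χ a`) — the value
`exp(ld_chi + ld_polar(χ a) − ld_polar(a))` the engine books for `cell = 'polar'`.  Then
`HasJacobian (Leb|_{alcove}) G J_G`. -/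
theorem hasJacobian_alcove_of_polarBoxFlow_su3_booked {χ : (Fin 2 → ℝ) → (Fin 2 → ℝ)} {Jχ : (Fin 2 → ℝ) → ℝ≥0∞}
    (hχ : HasJacobian (volume.restrict (Set.pi univ fun _ : Fin 2 => Ioo (0 : ℝ) 1)) χ Jχ)
    (hχbox : ∀ᵐ a ∂(volume.restrict (Set.pi univ fun _ : Fin 2 => Ioo (0 : ℝ) 1)),
      χ a ∈ Set.pi univ fun _ : Fin 2 => Ioo (0 : ℝ) 1)
    {G : (Fin 2 → ℝ) → (Fin 2 → ℝ)} (hG : Measurable G) {JG : (Fin 2 → ℝ) → ℝ≥0∞} (hJG : Measurable JG)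
    (hcomm : ∀ᵐ a ∂(volume.restrict (Set.pi univ fun _ : Fin 2 => Ioo (0 : ℝ) 1)), G (Q (T a)) = Q (T (χ a)))
    (hJ : ∀ᵐ a ∂(volume.restrict (Set.pi univ fun _ : Fin 2 => Ioo (0 : ℝ) 1)),
      JG (Q (T a)) =
        ENNReal.ofReal (((T (χ a)) 1 * (π / (Real.sqrt 3 * Real.cos ((T (χ a)) 0 - π / 6))) * (π / 3)) /
            ((T a) 1 * (π / (Real.sqrt 3 * Real.cos ((T a) 0 - π / 6))) * (π / 3))) *
          Jχ a) :
    HasJacobian (volume.restrict {θ : Fin 2 → ℝ | θ 0 < θ 1 ∧ θ 1 < -(θ 0 + θ 1) ∧ -(θ 0 + θ 1) < θ 0 + 2 * π}) G JG := by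
  refine hasJacobian_alcove_of_polarBoxFlow_su3 hT hQ hχ hG hJG hcomm ?_
  have hB : ∀ᵐ a ∂(volume.restrict (Set.pi univ fun _ : Fin 2 => Ioo (0 : ℝ) 1)),
      a ∈ Set.pi univ fun _ : Fin 2 => Ioo (0 : ℝ) 1 := ae_restrict_mem measurableSet_openBox_two
  filter_upwards [hJ, hχbox, hB] with a hJa hχa haB
  rw [hJa, polarDensity_ratio_eq_booked hT haB hχa]

end PolarCellBooked

end Summit.Ventures.LatticeQCDFlow.Exactness
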